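import Summits.NavierStokesRegularity.FluidComputer.RowSegmentSound
import HarnessLib

/-!
# The k53d chain: certified read-out of the designed start and end states (layer R certificate;
# `pub-fluidc-bp3/R1-DESIGN.md` §11.10)

HONEST FRAMING (cell `pub-fluidc`, blueprint seat bp3, gen 22): low prior, high value-of-information
experiment on Tao's machine paradigm; NOT a claim that NS blows up.

WHAT. Rational facts about two rows of the chain of record `RowChain.allRows`, by `native_decide`
(finite evaluation of degree-`5` rational polynomials and dyadic table entries; `--computational`
like the run files): the START `x̂₀(0)` has `a₁ ≥ 0.9961` and total energy `∑ x̂₀(0)ᵢ² ≤ 1`; the END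
`x̂₁₀₆₅(H₁₀₆₅)` widened by the last row's tube radii `Ē₁₀₆₅ = Eb/2^P` has next-scale carrier
`a₂ ≥ 2409/2500 = 0.9636` and every coordinate capped by `capQ` (`b₁`-residue `≤ 0.2563`, all of
the first gate's other modes and the second gate's non-carrier modes `≤ 0.086`). Consumed (cast to
`ℝ`) by `RowCircuitTransfer.lean`.

[cite: Tao2016AveragedNS, §5.5 Thm 5.3 (5.5)]
-/

namespace Summit.NavierStokesRegularity.FluidComputer

open Literature.Analysis.FluidPDE.FluidComputer

namespace RowChain

open RowCheck RowCheck.RowData RowRun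

/-- The designed end state, as rationals: row `1065`'s reference at its end. [folklore] -/
def XENDQ (a : Fin 9) : ℚ := evalQ ((row 1065).CQ a) (row 1065).Hq

/-- The designed start state, as rationals: row `0`'s reference at `0`. [folklore] -/
def X0Q (a : Fin 9) : ℚ := ((row 0).CQ a).getD 0 0

/-- Caps on `|x̂₁₀₆₅(H)| + Ē₁₀₆₅`, coordinatewise (`a₁ b₁ c₁ d₁ a₂ b₂ c₂ d₂ e₂`). [folklore] -/
def capQ : Fin 9 → ℚ :=
  ![9 / 2500, 2563 / 10000, 127 / 10000, 3 / 25000, 9679 / 10000, 107 / 1250, 1 / 156250,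
    171 / 100000, 47 / 5000]

/-- **End read-out**: the carrier of the second gate holds at least `0.9636` at the end of the
last row's tube, and every coordinate is capped. [folklore] -/
theorem end_readoutQ :
    (2409 : ℚ) / 2500 ≤ XENDQ 4 - ((row 1065).Eb 4 : ℚ) / 2 ^ (row 1065).P ∧
      ∀ a : Fin 9, |XENDQ a| + ((row 1065).Eb a : ℚ) / 2 ^ (row 1065).P ≤ capQ a := by
  native_decide

/-- **Start read-out**: lock coordinate `b₁`, carrier `a₁ ≥ 0.9961`, energy at most `1`.
[folklore] -/
theorem start_readoutQ :
    (row 0).p = 1 ∧ (9961 : ℚ) / 10000 ≤ X0Q 0 ∧ ∑ a : Fin 9, X0Q a ^ 2 ≤ 1 := by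
  native_decide

end RowChain

end Summit.NavierStokesRegularity.FluidComputer
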